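import Literature.NumberTheory.LFunctions.PrimeIdealChebyshev
import HarnessLib

/-!
# The von Mangoldt weight `Λ_K` and the Chebyshev function `ψ_K` of a number field

Topic `Literature/NumberTheory/LFunctions` (sibling of `PrimeIdealTheorem.lean` and
`PrimeIdealChebyshev.lean`). Second brick, bottom-up, of the decomposition of the named fact
`Literature.NumberTheory.LFunctions.NumberField.primeIdealTheorem` (`π_K(x) = Li(x) + O_K(x e^{−c√log x})`):
the analytic machine (Perron's formula applied to `−ζ_K'/ζ_K(s) = ∑ₙ Λ_K(n) n⁻ˢ` and a contour
shift into the zero-free region) naturally produces the `ψ_K`-form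
`ψ_K(x) = ∑_{n ≤ x} Λ_K(n) = x + O_K(x e^{−c√log x})` (Montgomery–Vaughan 2007, Theorem 8.9 with
(6.12) of Theorem 6.9; Landau 1903, Part II §§11–12). This file proves, sorry-free, that the
`ψ_K`-form implies the `θ_K`-form `chebyshevThetaPrimeIdealTheorem` of `PrimeIdealChebyshev.lean`
(prime-ideal powers contribute `≤ π_K(√x) log x ≪_K √x log x`), hence `primeIdealTheorem`.

## Content (namespace `Literature.NumberField`)

* `vonMangoldtIdeal K n = Λ_K(n) = ∑_{𝔭, m ≥ 1, N𝔭^m = n} log N𝔭` — Landau's `L_κ(n)`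
  ("`∑ log N𝔭` over the prime ideals `𝔭` of which `n` is the norm or a norm-power", p. 668), the
  `n`-th coefficient of the Dirichlet series `−ζ_K'/ζ_K(s)`.
* `chebyshevPsiIdeal K x = ψ_K(x) = ∑_{n ≤ x} Λ_K(n)`;
  `chebyshevPsiIdeal_eq_sum_primeIdealsLE`: `ψ_K(x) = ∑_{N𝔭 ≤ x} c_𝔭(x) log N𝔭` with
  `c_𝔭(x) = #{m ≥ 1 : N𝔭^m ≤ x}` (`normPowCount`).
* `chebyshevThetaIdeal_le_chebyshevPsiIdeal` (`θ_K ≤ ψ_K`) and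
  `chebyshevPsiIdeal_sub_chebyshevThetaIdeal_le` (`ψ_K(x) − θ_K(x) ≤ π_K(√x) log x`, `x ≥ 1`), proved.
* `primeIdealCount_le_of_chebyshevPsiIdeal_le` — a Chebyshev-type bound `π_K(y) ≤ A' y` from
  `ψ_K(y) ≤ A y`, by the partial summation of `PrimeIdealChebyshev.lean` (proved).
* `chebyshevPsiPrimeIdealTheorem` — NAMED FACT: `|ψ_K(x) − x| ≤ C_K x e^{−c_K√log x}` (`x ≥ 2`)
  (Montgomery–Vaughan 2007, Thm 8.9 with (6.12); Landau 1903 has the weaker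
  `O(x e^{−(log x)^{1/γ}})`).
* `chebyshevThetaIdeal_sub_self_le` — PROVED: the `ψ_K` bound with `(c, C)` gives the `θ_K` bound
  with `c' = min c (1/8)` and an explicit `C'`.
* `chebyshevThetaPrimeIdealTheorem_of_chebyshevPsi`, `primeIdealTheorem_of_chebyshevPsi` — PROVED.

## References

* E. Landau, *Neuer Beweis des Primzahlsatzes und Beweis des Primidealsatzes*, Math. Ann. 56
  (1903), 645–670, Part II §§11–14 (`LandauMathAnn1903`).
* H. L. Montgomery, R. C. Vaughan, *Multiplicative Number Theory I. Classical Theory*,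
  Cambridge Stud. Adv. Math. 97 (2007), Theorem 8.9 (p. 267), Theorem 6.9, Cor. 2.5
  (`MontgomeryVaughan2007`).
-/

noncomputable section

open scoped NumberField
open Finset Real MeasureTheory

namespace Literature.NumberTheory.LFunctions.NumberField

variable (K : Type*) [Field K] [NumberField K]

/-! ### Norms of nonzero prime ideals -/

variable {K} in
/-- A nonzero prime ideal of `𝓞 K` has absolute norm at least `2` (norm `0` means `⊥`, norm `1`
means `⊤`). [folklore] -/
theorem two_le_absNorm_of_isPrime {P : Ideal (𝓞 K)} (hP : P.IsPrime) (hP0 : P ≠ ⊥) :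
    2 ≤ Ideal.absNorm P := by
  have h0 : Ideal.absNorm P ≠ 0 := fun h => hP0 (Ideal.absNorm_eq_zero_iff.mp h)
  have h1 : Ideal.absNorm P ≠ 1 := fun h => hP.ne_top (Ideal.absNorm_eq_one_iff.mp h)
  omega

/-- `π_K(y) = 0` for `y < 2`. [folklore] -/
theorem primeIdealCount_eq_zero_of_lt_two {y : ℝ} (hy : y < 2) : primeIdealCount K y = 0 := by
  rw [primeIdealCount, Set.ncard_eq_zero (finite_primeIdealsLE K y)]
  ext P
  simp only [primeIdealsLE, Set.mem_setOf_eq, Set.mem_empty_iff_false, iff_false, not_and,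
    not_le]
  intro hP hP0
  have := two_le_absNorm_of_isPrime hP hP0
  exact hy.trans_le (by exact_mod_cast this)

/-! ### `Λ_K` and `ψ_K` -/

/-- The von Mangoldt weight of the number field `K` on `ℕ`:
`Λ_K(n) = ∑ log N𝔭` over the nonzero prime ideals `𝔭` of `𝓞 K` such that `n = N𝔭^m` for some
`m ≥ 1` (Landau's `L_κ(n)`, p. 668: the `n`-th coefficient of `−ζ_κ'/ζ_κ(s) = ∑ L_κ(n) n⁻ˢ`).
The condition is written `n ∈ image (N𝔭 ^ ·) {1, …, n}` (decidable); searching `m ≤ n` loses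
nothing since `N𝔭 ≥ 2` forces `m < n`.
[cite: LandauMathAnn1903, §11 p. 668] -/
def vonMangoldtIdeal (n : ℕ) : ℝ :=
  ∑ P ∈ (finite_primeIdealsLE K n).toFinset,
    if n ∈ (Icc 1 n).image (fun m => Ideal.absNorm P ^ m) then Real.log (Ideal.absNorm P) else 0

/-- The Chebyshev function `ψ_K(x) = ∑_{n ≤ x} Λ_K(n) = ∑_{N𝔭^m ≤ x, m ≥ 1} log N𝔭` of the number
field `K` (Landau 1903, §12; Montgomery–Vaughan 2007, p. 267). [cite: LandauMathAnn1903, §12 p. 669] -/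
def chebyshevPsiIdeal (x : ℝ) : ℝ :=
  ∑ n ∈ Icc 0 ⌊x⌋₊, vonMangoldtIdeal K n

/-- `Λ_K ≥ 0`. [folklore] -/
theorem vonMangoldtIdeal_nonneg (n : ℕ) : 0 ≤ vonMangoldtIdeal K n := by
  unfold vonMangoldtIdeal
  refine sum_nonneg fun P _ => ?_
  split_ifs
  · exact Real.log_natCast_nonneg _
  · exact le_rfl

/-- `ψ_K ≥ 0`. [folklore] -/
theorem chebyshevPsiIdeal_nonneg (x : ℝ) : 0 ≤ chebyshevPsiIdeal K x :=
  sum_nonneg fun n _ => vonMangoldtIdeal_nonneg K n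

/-- `c_𝔭(x)`: the number of `n ≤ x` with `N𝔭 ≤ n` that are powers `N𝔭^m`, `m ≥ 1` — i.e. the
number of `m ≥ 1` with `N𝔭^m ≤ x`. [folklore] -/
def normPowCount (x : ℝ) (P : Ideal (𝓞 K)) : ℕ :=
  ((Icc 0 ⌊x⌋₊).filter fun n =>
    Ideal.absNorm P ≤ n ∧ n ∈ (Icc 1 n).image (fun m => Ideal.absNorm P ^ m)).card

variable {K} in
/-- For `n ≤ x`, the prime ideals of norm `≤ n` are those of norm `≤ x` filtered by `N𝔭 ≤ n`.
[folklore] -/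
theorem primeIdealsLE_toFinset_natCast {x : ℝ} {n : ℕ} (hn : (n : ℝ) ≤ x) :
    (finite_primeIdealsLE K n).toFinset =
      ((finite_primeIdealsLE K x).toFinset).filter fun P => Ideal.absNorm P ≤ n := by
  ext P
  simp only [Set.Finite.mem_toFinset, primeIdealsLE, Set.mem_setOf_eq, mem_filter, Nat.cast_le]
  constructor
  · rintro ⟨h1, h2, h3⟩
    exact ⟨⟨h1, h2, (Nat.cast_le.mpr h3).trans hn⟩, h3⟩
  · rintro ⟨⟨h1, h2, -⟩, h3⟩
    exact ⟨h1, h2, h3⟩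

/-- `ψ_K(x) = ∑_{N𝔭 ≤ x} c_𝔭(x) log N𝔭` (interchange of summations; Landau 1903, §12).
[cite: LandauMathAnn1903, §12 p. 669] -/
theorem chebyshevPsiIdeal_eq_sum_primeIdealsLE {x : ℝ} (hx : 0 ≤ x) :
    chebyshevPsiIdeal K x =
      ∑ P ∈ (finite_primeIdealsLE K x).toFinset,
        (normPowCount K x P : ℝ) * Real.log (Ideal.absNorm P) := by
  unfold chebyshevPsiIdeal vonMangoldtIdeal
  have hT : ∀ n ∈ Icc 0 ⌊x⌋₊, (n : ℝ) ≤ x := fun n hn =>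
    (Nat.le_floor_iff hx).mp (mem_Icc.mp hn).2
  calc ∑ n ∈ Icc 0 ⌊x⌋₊, ∑ P ∈ (finite_primeIdealsLE K n).toFinset,
          (if n ∈ (Icc 1 n).image (fun m => Ideal.absNorm P ^ m) then
            Real.log (Ideal.absNorm P) else 0)
      = ∑ n ∈ Icc 0 ⌊x⌋₊, ∑ P ∈ (finite_primeIdealsLE K x).toFinset,
          (if Ideal.absNorm P ≤ n ∧ n ∈ (Icc 1 n).image (fun m => Ideal.absNorm P ^ m) then
            Real.log (Ideal.absNorm P) else 0) := by
        refine sum_congr rfl fun n hn => ?_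
        rw [primeIdealsLE_toFinset_natCast (hT n hn), sum_filter]
        refine sum_congr rfl fun P _ => ?_
        rw [ite_and]
    _ = ∑ P ∈ (finite_primeIdealsLE K x).toFinset, ∑ n ∈ Icc 0 ⌊x⌋₊,
          (if Ideal.absNorm P ≤ n ∧ n ∈ (Icc 1 n).image (fun m => Ideal.absNorm P ^ m) then
            Real.log (Ideal.absNorm P) else 0) := sum_comm
    _ = _ := by
        refine sum_congr rfl fun P _ => ?_
        rw [← sum_filter, sum_const, nsmul_eq_mul, normPowCount]

variable {K} in
/-- `c_𝔭(x) ≥ 1` when `N𝔭 ≤ x` (take `n = N𝔭`, `m = 1`). [folklore] -/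
theorem one_le_normPowCount {x : ℝ} {P : Ideal (𝓞 K)}
    (hP : P ∈ (finite_primeIdealsLE K x).toFinset) : 1 ≤ normPowCount K x P := by
  rw [Set.Finite.mem_toFinset] at hP
  obtain ⟨h1, h2, h3⟩ := hP
  have h2' := two_le_absNorm_of_isPrime h1 h2
  rw [normPowCount, Nat.one_le_iff_ne_zero, Ne, card_eq_zero, ← Ne, ← nonempty_iff_ne_empty]
  refine ⟨Ideal.absNorm P, mem_filter.mpr ⟨mem_Icc.mpr ⟨Nat.zero_le _, Nat.le_floor h3⟩, le_rfl,
    mem_image.mpr ⟨1, mem_Icc.mpr ⟨le_rfl, by omega⟩, pow_one _⟩⟩⟩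

variable {K} in
/-- `c_𝔭(x) ≤ log x / log N𝔭` for `x ≥ 1`: the elements counted are `N𝔭^m` with
`1 ≤ m ≤ log x / log N𝔭`. [folklore] -/
theorem normPowCount_le {x : ℝ} (hx : 1 ≤ x) {P : Ideal (𝓞 K)} (hP2 : 2 ≤ Ideal.absNorm P) :
    (normPowCount K x P : ℝ) ≤ Real.log x / Real.log (Ideal.absNorm P) := by
  set q : ℕ := Ideal.absNorm P with hq
  have hq1 : (1 : ℝ) < q := by exact_mod_cast hP2
  have hlogq : 0 < Real.log q := Real.log_pos hq1
  have hlx : 0 ≤ Real.log x := Real.log_nonneg hx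
  set T : ℕ := ⌊Real.log x / Real.log q⌋₊ with hT
  have hsub : ((Icc 0 ⌊x⌋₊).filter fun n => q ≤ n ∧ n ∈ (Icc 1 n).image (fun m => q ^ m)) ⊆
      (Icc 1 T).image fun m => q ^ m := by
    intro n hn
    rw [mem_filter, mem_Icc, mem_image] at hn
    obtain ⟨⟨-, hnx⟩, -, m, hm, hmn⟩ := hn
    rw [mem_image]
    refine ⟨m, mem_Icc.mpr ⟨(mem_Icc.mp hm).1, ?_⟩, hmn⟩
    refine Nat.le_floor ?_
    rw [le_div_iff₀ hlogq, ← Real.log_pow]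
    refine Real.log_le_log (by positivity) ?_
    have h1 : ((q ^ m : ℕ) : ℝ) ≤ ⌊x⌋₊ := by exact_mod_cast hmn ▸ hnx
    calc (q : ℝ) ^ m = ((q ^ m : ℕ) : ℝ) := by push_cast; ring
      _ ≤ ⌊x⌋₊ := h1
      _ ≤ x := Nat.floor_le (by linarith)
  calc (normPowCount K x P : ℝ) ≤ ((Icc 1 T).image fun m => q ^ m).card := by
        exact_mod_cast (card_le_card hsub : normPowCount K x P ≤ _)
    _ ≤ (Icc 1 T).card := by exact_mod_cast card_image_le
    _ = T := by simp
    _ ≤ Real.log x / Real.log q := Nat.floor_le (div_nonneg hlx hlogq.le)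

/-- `θ_K ≤ ψ_K`. [folklore] -/
theorem chebyshevThetaIdeal_le_chebyshevPsiIdeal (x : ℝ) :
    chebyshevThetaIdeal K x ≤ chebyshevPsiIdeal K x := by
  rcases lt_or_ge x 0 with hx | hx
  · rw [chebyshevThetaIdeal_eq_zero_of_lt_two K (by linarith)]
    exact chebyshevPsiIdeal_nonneg K x
  rw [chebyshevThetaIdeal_eq_sum_primeIdealsLE K hx, chebyshevPsiIdeal_eq_sum_primeIdealsLE K hx]
  refine sum_le_sum fun P hP => ?_
  have h1 : (1 : ℝ) ≤ normPowCount K x P := by exact_mod_cast one_le_normPowCount hP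
  have h0 : 0 ≤ Real.log (Ideal.absNorm P : ℝ) := Real.log_natCast_nonneg _
  nlinarith

/-- **Prime-ideal powers are negligible**: `ψ_K(x) − θ_K(x) ≤ π_K(√x) · log x` for `x ≥ 1`
(only `𝔭` with `N𝔭 ≤ √x` have a proper power of norm `≤ x`, and each contributes at most
`log x / log N𝔭` powers; Landau 1903, p. 669: `∑_{N𝔭^ν ≤ x, ν ≥ 2} log N𝔭 = O(√x log² x)`;
Montgomery–Vaughan 2007, Cor. 2.5 for `K = ℚ`). [cite: LandauMathAnn1903, §12 p. 669] -/
theorem chebyshevPsiIdeal_sub_chebyshevThetaIdeal_le {x : ℝ} (hx : 1 ≤ x) :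
    chebyshevPsiIdeal K x - chebyshevThetaIdeal K x ≤
      (primeIdealCount K (Real.sqrt x) : ℝ) * Real.log x := by
  have hx0 : (0 : ℝ) ≤ x := by linarith
  have hlx : 0 ≤ Real.log x := Real.log_nonneg hx
  set S := (finite_primeIdealsLE K x).toFinset with hS
  rw [chebyshevThetaIdeal_eq_sum_primeIdealsLE K hx0, chebyshevPsiIdeal_eq_sum_primeIdealsLE K hx0,
    ← sum_sub_distrib]
  -- the count `π_K(√x)` as a filter of `S`
  have hsqrt : Real.sqrt x ≤ x := by
    rw [Real.sqrt_le_left hx0]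
    nlinarith
  have hπ : (primeIdealCount K (Real.sqrt x) : ℝ) =
      (S.filter fun P => (Ideal.absNorm P : ℝ) ≤ Real.sqrt x).card := by
    rw [primeIdealCount, Set.ncard_eq_toFinset_card _ (finite_primeIdealsLE K (Real.sqrt x))]
    congr 2
    ext P
    simp only [Set.Finite.mem_toFinset, primeIdealsLE, Set.mem_setOf_eq, mem_filter, S]
    constructor
    · rintro ⟨h1, h2, h3⟩
      exact ⟨⟨h1, h2, h3.trans hsqrt⟩, h3⟩
    · rintro ⟨⟨h1, h2, -⟩, h3⟩
      exact ⟨h1, h2, h3⟩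
  rw [hπ, ← sum_filter_add_sum_filter_not S (fun P => (Ideal.absNorm P : ℝ) ≤ Real.sqrt x)]
  have hmem : ∀ P ∈ S, 2 ≤ Ideal.absNorm P := fun P hP => by
    rw [hS, Set.Finite.mem_toFinset] at hP
    exact two_le_absNorm_of_isPrime hP.1 hP.2.1
  -- small primes: each term is at most `log x`
  have h1 : ∑ P ∈ S.filter (fun P => (Ideal.absNorm P : ℝ) ≤ Real.sqrt x),
      ((normPowCount K x P : ℝ) * Real.log (Ideal.absNorm P) - Real.log (Ideal.absNorm P)) ≤
      ∑ P ∈ S.filter (fun P => (Ideal.absNorm P : ℝ) ≤ Real.sqrt x), Real.log x := by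
    refine sum_le_sum fun P hP => ?_
    have hP2 := hmem P (mem_filter.mp hP).1
    have hlogq : 0 < Real.log (Ideal.absNorm P : ℝ) := Real.log_pos (by exact_mod_cast hP2)
    have hc := normPowCount_le (K := K) hx hP2
    rw [le_div_iff₀ hlogq] at hc
    linarith
  -- large primes: `c_𝔭(x) ≤ 1`, the term is `≤ 0`
  have h2 : ∑ P ∈ S.filter (fun P => ¬ (Ideal.absNorm P : ℝ) ≤ Real.sqrt x),
      ((normPowCount K x P : ℝ) * Real.log (Ideal.absNorm P) - Real.log (Ideal.absNorm P)) ≤ 0 := by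
    refine sum_nonpos fun P hP => ?_
    obtain ⟨hPS, hPq⟩ := mem_filter.mp hP
    have hP2 := hmem P hPS
    replace hPq := not_le.mp hPq
    have hq0 : (0 : ℝ) < Ideal.absNorm P := by positivity
    have hlogq : 0 < Real.log (Ideal.absNorm P : ℝ) := Real.log_pos (by exact_mod_cast hP2)
    have hlogq2 : Real.log x < 2 * Real.log (Ideal.absNorm P : ℝ) := by
      have h := Real.log_lt_log (Real.sqrt_pos.mpr (by linarith)) hPq
      rw [Real.log_sqrt hx0] at h
      linarith
    have hc := normPowCount_le (K := K) hx hP2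
    have hc2 : (normPowCount K x P : ℝ) < 2 := by
      rw [le_div_iff₀ hlogq] at hc
      nlinarith
    have hc1 : (normPowCount K x P : ℝ) ≤ 1 := by
      have : normPowCount K x P < 2 := by exact_mod_cast hc2
      exact_mod_cast Nat.lt_succ_iff.mp this
    nlinarith
  calc _ ≤ ∑ P ∈ S.filter (fun P => (Ideal.absNorm P : ℝ) ≤ Real.sqrt x), Real.log x + 0 :=
        add_le_add h1 h2
    _ = _ := by rw [sum_const, nsmul_eq_mul, add_zero]

/-! ### A Chebyshev-type bound for `π_K` from one for `ψ_K` -/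

variable {K} in
/-- If `ψ_K(y) ≤ A y` for all `y ≥ 2` then `π_K(y) ≤ A (1/log 2 + 1/log² 2) y` for all `y ≥ 2`
(partial summation `primeIdealCount_eq_theta_div_log_add_integral` and `θ_K ≤ ψ_K`).
[folklore] -/
theorem primeIdealCount_le_of_chebyshevPsiIdeal_le {A : ℝ}
    (hA : ∀ y : ℝ, 2 ≤ y → chebyshevPsiIdeal K y ≤ A * y) {y : ℝ} (hy : 2 ≤ y) :
    (primeIdealCount K y : ℝ) ≤ A * (1 / Real.log 2 + 1 / Real.log 2 ^ 2) * y := by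
  have hA0 : 0 ≤ A := by
    have := (chebyshevPsiIdeal_nonneg K 2).trans (hA 2 le_rfl)
    linarith
  have hlog2 : (0.6931471803 : ℝ) < Real.log 2 := Real.log_two_gt_d9
  have hL2 : 0 < Real.log 2 := by linarith
  have hLy : Real.log 2 ≤ Real.log y := Real.log_le_log two_pos hy
  have hθ : ∀ t : ℝ, 2 ≤ t → chebyshevThetaIdeal K t ≤ A * t := fun t ht =>
    (chebyshevThetaIdeal_le_chebyshevPsiIdeal K t).trans (hA t ht)
  rw [primeIdealCount_eq_theta_div_log_add_integral K hy]
  have hintθ : IntervalIntegrable (fun t ↦ chebyshevThetaIdeal K t / (t * Real.log t ^ 2))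
      volume 2 y := by
    rw [intervalIntegrable_iff, Set.uIoc_of_le hy, ← integrableOn_Icc_iff_integrableOn_Ioc]
    exact integrableOn_chebyshevThetaIdeal_div K y
  have hI : ∫ t in (2 : ℝ)..y, chebyshevThetaIdeal K t / (t * Real.log t ^ 2) ≤
      A / Real.log 2 ^ 2 * y := by
    calc ∫ t in (2 : ℝ)..y, chebyshevThetaIdeal K t / (t * Real.log t ^ 2)
        ≤ ∫ _ in (2 : ℝ)..y, A / Real.log 2 ^ 2 := by
          refine intervalIntegral.integral_mono_on hy hintθ (by simp) fun t ht => ?_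
          have ht0 : 0 < t := by linarith [ht.1]
          have hlt : Real.log 2 ≤ Real.log t := Real.log_le_log two_pos ht.1
          have hlt0 : 0 < Real.log t := by linarith
          rw [div_le_div_iff₀ (by positivity) (by positivity)]
          calc chebyshevThetaIdeal K t * Real.log 2 ^ 2 ≤ A * t * Real.log 2 ^ 2 :=
                mul_le_mul_of_nonneg_right (hθ t ht.1) (by positivity)
            _ ≤ A * (t * Real.log t ^ 2) := by
                rw [mul_assoc]
                refine mul_le_mul_of_nonneg_left (mul_le_mul_of_nonneg_left ?_ ht0.le) hA0
                exact pow_le_pow_left₀ hL2.le hlt 2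
      _ = (y - 2) * (A / Real.log 2 ^ 2) := by
          rw [intervalIntegral.integral_const, smul_eq_mul]
      _ ≤ A / Real.log 2 ^ 2 * y := by
          have : 0 ≤ A / Real.log 2 ^ 2 := by positivity
          nlinarith
  have hB : chebyshevThetaIdeal K y / Real.log y ≤ A / Real.log 2 * y := by
    rw [div_le_iff₀ (by linarith)]
    calc chebyshevThetaIdeal K y ≤ A * y := hθ y hy
      _ = A / Real.log 2 * y * Real.log 2 := by field_simp
      _ ≤ A / Real.log 2 * y * Real.log y :=
          mul_le_mul_of_nonneg_left hLy (by positivity)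
  calc chebyshevThetaIdeal K y / Real.log y +
        ∫ t in (2 : ℝ)..y, chebyshevThetaIdeal K t / (t * Real.log t ^ 2)
      ≤ A / Real.log 2 * y + A / Real.log 2 ^ 2 * y := add_le_add hB hI
    _ = A * (1 / Real.log 2 + 1 / Real.log 2 ^ 2) * y := by ring

/-! ### From `ψ_K(x) = x + O(x e^{−c√log x})` to the same for `θ_K` -/

variable {K} in
/-- **`θ_K` from `ψ_K`** (Landau 1903, §12, p. 669; Montgomery–Vaughan 2007, proof of Thm 8.9 as in
Thm 6.9): if `|ψ_K(x) − x| ≤ C x e^{−c√log x}` for `x ≥ 2` (`c > 0`) then for `x ≥ 2`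
`|θ_K(x) − x| ≤ C' x e^{−c'√log x}` with `c' = min c (1/8)` and
`C' = C + 4 e^{1/8} (1 + C)(1/log 2 + 1/log² 2)`. [cite: LandauMathAnn1903, §12 p. 669] -/
theorem chebyshevThetaIdeal_sub_self_le {c C : ℝ} (hc : 0 < c)
    (hψ : ∀ x : ℝ, 2 ≤ x →
      |chebyshevPsiIdeal K x - x| ≤ C * x * Real.exp (-c * Real.sqrt (Real.log x)))
    {x : ℝ} (hx : 2 ≤ x) :
    |chebyshevThetaIdeal K x - x| ≤
      (C + 4 * Real.exp (1 / 8) * ((1 + C) * (1 / Real.log 2 + 1 / Real.log 2 ^ 2))) *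
        x * Real.exp (-min c (1 / 8) * Real.sqrt (Real.log x)) := by
  set c' : ℝ := min c (1 / 8) with hc'
  have hC : 0 ≤ C := by
    have h := (abs_nonneg _).trans (hψ 2 le_rfl)
    have h2 : 0 < (2 : ℝ) * Real.exp (-c * Real.sqrt (Real.log 2)) := by positivity
    nlinarith
  have hx0 : 0 < x := by linarith
  have hx1 : 1 ≤ x := by linarith
  set L : ℝ := Real.log x with hLdef
  have hlog2 : (0.6931471803 : ℝ) < Real.log 2 := Real.log_two_gt_d9
  have hL : Real.log 2 ≤ L := Real.log_le_log two_pos hx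
  have hLpos : 0 < L := by linarith
  have hc'c : c' ≤ c := min_le_left _ _
  have hc'8 : c' ≤ 1 / 8 := min_le_right _ _
  have hc'0 : 0 < c' := lt_min hc (by norm_num)
  set g : ℝ := Real.exp (-c' * Real.sqrt L) with hgdef
  have hxL : Real.exp L = x := by rw [hLdef]; exact Real.exp_log hx0
  have hsqrtL0 : 0 ≤ Real.sqrt L := Real.sqrt_nonneg _
  have hsqrtL : Real.sqrt L ≤ 1 + L := by
    rw [Real.sqrt_le_left (by linarith)]
    nlinarith
  -- `ψ_K(y) ≤ (1 + C) y` for `y ≥ 2`, hence `π_K(y) ≤ A₂ y`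
  set A₂ : ℝ := (1 + C) * (1 / Real.log 2 + 1 / Real.log 2 ^ 2) with hA₂
  have hA₂0 : 0 ≤ A₂ := by positivity
  have hψle : ∀ y : ℝ, 2 ≤ y → chebyshevPsiIdeal K y ≤ (1 + C) * y := by
    intro y hy
    have h := (le_abs_self _).trans (hψ y hy)
    have he : Real.exp (-c * Real.sqrt (Real.log y)) ≤ 1 := by
      rw [Real.exp_le_one_iff]
      nlinarith [Real.sqrt_nonneg (Real.log y)]
    have h0 : 0 ≤ C * y := mul_nonneg hC (by linarith)
    nlinarith
  have hπ : (primeIdealCount K (Real.sqrt x) : ℝ) ≤ A₂ * Real.sqrt x := by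
    rcases lt_or_ge (Real.sqrt x) 2 with h | h
    · rw [primeIdealCount_eq_zero_of_lt_two K h, Nat.cast_zero]
      positivity
    · exact primeIdealCount_le_of_chebyshevPsiIdeal_le hψle h
  -- `√x log x ≤ 4 e^{1/8} x g`
  have hkey : Real.sqrt x * L ≤ 4 * Real.exp (1 / 8) * (x * g) := by
    have h1 : Real.sqrt x = Real.exp (L / 2) := by
      rw [← Real.log_sqrt hx0.le, Real.exp_log (Real.sqrt_pos.mpr hx0)]
    have h2 : L ≤ 4 * Real.exp (L / 4) := by
      have := Real.add_one_le_exp (L / 4)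
      linarith
    have hxg : x * g = Real.exp (L - c' * Real.sqrt L) := by
      rw [← hxL, hgdef, ← Real.exp_add]
      ring_nf
    have h4 : Real.exp (L / 2) * (4 * Real.exp (L / 4)) = 4 * Real.exp (L / 2 + L / 4) := by
      rw [Real.exp_add]; ring
    calc Real.sqrt x * L ≤ Real.exp (L / 2) * (4 * Real.exp (L / 4)) := by
          rw [h1]; exact mul_le_mul_of_nonneg_left h2 (Real.exp_nonneg _)
      _ = 4 * Real.exp (L / 2 + L / 4) := h4
      _ ≤ 4 * Real.exp (1 / 8 + (L - c' * Real.sqrt L)) := by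
          refine mul_le_mul_of_nonneg_left (Real.exp_le_exp.mpr ?_) (by norm_num)
          nlinarith
      _ = 4 * Real.exp (1 / 8) * (x * g) := by
          rw [Real.exp_add, hxg]
          ring
  -- assemble
  have hθψ := chebyshevThetaIdeal_le_chebyshevPsiIdeal K x
  have hdiff := chebyshevPsiIdeal_sub_chebyshevThetaIdeal_le K hx1
  have habs : |chebyshevThetaIdeal K x - x| ≤
      |chebyshevPsiIdeal K x - x| + (chebyshevPsiIdeal K x - chebyshevThetaIdeal K x) := by
    have h1 : |chebyshevThetaIdeal K x - chebyshevPsiIdeal K x| =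
        chebyshevPsiIdeal K x - chebyshevThetaIdeal K x := by
      rw [abs_sub_comm]
      exact abs_of_nonneg (by linarith)
    have h2 := abs_sub_le (chebyshevThetaIdeal K x) (chebyshevPsiIdeal K x) x
    linarith
  calc |chebyshevThetaIdeal K x - x|
      ≤ |chebyshevPsiIdeal K x - x| + (chebyshevPsiIdeal K x - chebyshevThetaIdeal K x) := habs
    _ ≤ C * x * Real.exp (-c * Real.sqrt L) + A₂ * Real.sqrt x * L := by
        refine add_le_add (hψ x hx) (hdiff.trans ?_)
        exact mul_le_mul_of_nonneg_right hπ hLpos.le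
    _ ≤ C * x * g + A₂ * (4 * Real.exp (1 / 8) * (x * g)) := by
        refine add_le_add ?_ ?_
        · refine mul_le_mul_of_nonneg_left (Real.exp_le_exp.mpr ?_) (mul_nonneg hC hx0.le)
          nlinarith
        · rw [mul_assoc]
          exact mul_le_mul_of_nonneg_left hkey hA₂0
    _ = (C + 4 * Real.exp (1 / 8) * A₂) * x * g := by ring

/-! ### The named fact and the reductions -/

/-- **The prime ideal theorem for `ψ_K`, with de la Vallée-Poussin error term** (NAMED FACT).
For every number field `K` there are constants `c_K > 0` and `C_K` such that for all `x ≥ 2`,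
`|ψ_K(x) − x| ≤ C_K · x · exp(−c_K √log x)`, where `ψ_K(x) = ∑_{n ≤ x} Λ_K(n)`.
This is the `ψ`-form of Montgomery–Vaughan's Theorem 8.9 (p. 267: from the zero-free region
`σ > 1 − c/log τ` for `ζ_K` "continuing as in Chapter 6", i.e. as (6.12) of their Theorem 6.9,
via Perron's formula, Theorem 5.2); Landau 1903, Part II §§11–12, proves the weaker
`O(x e^{−(log x)^{1/γ}})`. Constants depend on `K` only; `K : Type` as in `primeIdealTheorem`.
[cite: MontgomeryVaughan2007, Thm 8.9 (p. 267) with (6.12) of Thm 6.9] -/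
def chebyshevPsiPrimeIdealTheorem : Prop :=
  ∀ (K : Type) [Field K] [NumberField K],
    ∃ c : ℝ, 0 < c ∧ ∃ C : ℝ, ∀ x : ℝ, 2 ≤ x →
      |chebyshevPsiIdeal K x - x| ≤ C * x * Real.exp (-c * Real.sqrt (Real.log x))

/-- The `ψ_K`-form implies the `θ_K`-form (`chebyshevThetaIdeal_sub_self_le`).
[cite: LandauMathAnn1903, §12 p. 669] -/
theorem chebyshevThetaPrimeIdealTheorem_of_chebyshevPsi (h : chebyshevPsiPrimeIdealTheorem) :
    chebyshevThetaPrimeIdealTheorem := by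
  intro K _ _
  obtain ⟨c, hc, C, hψ⟩ := h K
  exact ⟨min c (1 / 8), lt_min hc (by norm_num), _,
    fun x hx ↦ chebyshevThetaIdeal_sub_self_le hc hψ hx⟩

/-- The `ψ_K`-form implies `primeIdealTheorem` (`π_K(x) = Li(x) + O_K(x e^{−c√log x})`), through
`θ_K` and partial summation (Landau 1903, §§12–14). [cite: LandauMathAnn1903, §§12–14 pp. 669–670] -/
theorem primeIdealTheorem_of_chebyshevPsi (h : chebyshevPsiPrimeIdealTheorem) :
    primeIdealTheorem :=
  primeIdealTheorem_of_chebyshevTheta (chebyshevThetaPrimeIdealTheorem_of_chebyshevPsi h)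

end Literature.NumberTheory.LFunctions.NumberField

end
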